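import Summits.FinalStateConjecture.FinalStateConjecture.Theses.KerrnessPropagates

/-!
# Birth skeleton (BC3) for the crux `KillingSpinorEndgame` (stmt-FinalStateConjecture-17645)
# of route `KerrnessPropagates` — line `birth`: DYNAMICS (eventual capture) + CONSOLIDATION (one convergent
# global gauge) + PACKAGING (honest exterior), composed into the crux by pure logic.

Target: `lean/Summits/FinalStateConjecture/FinalStateConjecture/Cruxes/KillingSpinorEndgame/Lines/birth.lean`.

The crux says: there is a regularity `k` such that every MGHD (admissible one-ended datum,
complete `𝓘⁺`) which (i) RECURS — for every `ε > 0` and beyond every lab time there is ONE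
future-oriented achronal slab chart in `J⁺(ιX)` which is `ε`-close in `Cᵏ` to a FIXED sub-extremal
multi-Kerr configuration `p = (N; Mᵢ, aᵢ, r₀ᵢ; Λᵢ, cᵢ)` on horizon-penetrating near discs and
`ε`-flat on the far zone — and (ii) satisfies the INTERIOR LEMMA (every honest `C²` Kerr
decomposition keeps the future-complete null rays from `Σ` in the closure of its exterior), admits
the Statement's conclusion: an exhaustive, future-oriented `C²` `FinalStateDecomposition` with
sub-extremal holes of the self-determined exterior `O = J⁺(ιX) ∩ I⁻(charted)` with
`RaysStayInClosure O`.

The line cuts the implication (i) ⇒ conclusion at ONE new typed object — a GLOBAL GAUGE ALONG AN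
ACCURACY PROFILE `δ` (`GaugeAlong … δ`: "the recurrence data made coherent in time" — ONE lab-time
chart `Φ` for ALL late times, achronal leaves in `J⁺(ιX)`, horizon-penetrating near discs
`{r₀ᵢ < rᵢ ≤ Rᵢ(τ)}` with `Rᵢ(τ) → ∞`, the far zone `{∀ j, rⱼ ≥ Rⱼ(τ) − 1}` ADJACENT to them (no
annulus), both `δ(τ)`-close in `Cᵏ`, `Φ_*∂₀` future-directed causal on the far zone; `GlobalGauge` =
some profile with `δ(τ) → 0`) — into THREE stubs of different nature, none of which is the crux or
the summit, each (morally) implied by the crux's conclusion and jointly implying it: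

* `stub_eventualCapture` (DYNAMICS; the crux's rank-2 difficulty lives here): recurrence at
  regularity `k` to a sub-extremal `p = (N; Mᵢ, aᵢ, r₀ᵢ; Λᵢ, cᵢ)` ⇒ for EVERY accuracy `η > 0` the
  development is eventually captured: a global `C²` gauge along the constant profile `η` to the
  SAME charges and motions, on near discs of some depths `r₀'ᵢ ∈ (r₋, r₊)` fixed once (red-shift
  region; the recurrence depth may sit at the Cauchy horizon, where nothing decays). KEY POINT OF
  THE CUT: because the crux GIVES recurrence for every `ε`, no decay RATE mechanism is ever needed —
  "liminf = 0 ⇒ lim = 0" asks only for ORBITAL (uniform-in-time, linear-in-the-data) control of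
  sub-extremal multi-Kerr in a lab-time gauge plus the monotone budgets that forbid infinitely many
  `O(1)` kicks (area theorem: the masses can only grow and recur to `Mᵢ`; Bondi mass loss). A
  ONE-SLAB ("threshold") capture statement would be FALSE as typed — the far-zone smallness is an
  unweighted sup norm, so one `ε`-good slab may store energy `ε²ρ² = O(1)` at radius `ρ ~ 1/ε` that
  later kicks the holes by `O(1)` — which is why the stub keeps the crux's full recurrence hypothesis.
  Intended engine: `KillingSpinorCoercivity` (item stmt-13853) makes the non-Kerrness of the good
  slabs `O(ε)`; the García-Parrado–Valiente Kroon obstruction `ζ = (H, S)` solves a closed homogeneous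
  linear system; hidden-symmetry commutators bound it uniformly (sub-extremality = red-shift);
  coercivity plus the KNOWN charges turn smallness of `ζ` into `C²` closeness of the lab chart.
* `stub_gaugeConsolidation` (SOFT ANALYSIS, L): eventual capture at every accuracy ⇒ ONE global
  gauge with `δ(τ) → 0`: realign the `η`-gauges by EXACT symmetries of the references (Poincaré maps
  for `η`; time translation along `Λᵢe₀` and axial rotation for Kerr–Schild Kerrᵢ — the near discs
  and the far zone are adjacent and the chart is one diffeomorphism, so the relative gauge map is
  close to ONE common symmetry), then interpolate geodesically over long lab-time windows; growing
  radii by diagonalisation.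
* `stub_exteriorPackaging` (LORENTZIAN CAUSAL GEOMETRY + chart surgery, L; AUDIT.md §D2 of the
  Statement made a theorem): an MGHD with complete `𝓘⁺` carrying a convergent global gauge to a
  sub-extremal configuration admits an HONEST decomposition: per-hole charts on the boosted Kerr
  exteriors `{rᵢ > r₊}` obtained from `Φ` by a decaying radial renormalisation that puts the event
  horizon inside the chart image and by compressing the uncontrolled far part of each boosted
  exterior into the lab-late region (open embeddings, junk-free); flat chart = `Φ` on the late
  half-space minus sublinear tubes `ρᵢ ≤ Rᵢ − 1` (no annulus); `O := J⁺(ιX) ∩ I⁻(charted)`;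
  exhaustion clause (ii) of `HasExhaustiveCharts` from the causal structure of near-Kerr / near-flat
  leaves (lab time is a time function on late leaves; the inner cylinders `{rᵢ = r₀ᵢ}`,
  `r₋ < r₀ᵢ < r₊`, are spacelike with future pointing inward, so nothing re-enters the charted region
  from the black holes); `IsFutureOriented` from the far-zone sign by continuity.

`KillingSpinorEndgame_of` composes: `k` from the dynamics stub; recurrence ⇒ eventual capture at
every accuracy ⇒ one convergent global gauge ⇒ honest `(O, d)`; the crux's own hypothesis (ii)
applied to `(O, d)` supplies `RaysStayInClosure O`. Sorries: exactly the three `stub_*`.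
Disproof.lean for this crux: none exists yet (no `_false_without_` obstruction to honour; `ledger
crux ls` showed no workfiles, 2026-08-17); the negatives index of the summit has no statement about
recurrence, global gauges or exterior packaging.
-/

open Literature.Geometry.Lorentzian
open scoped Manifold ContDiff Topology ENNReal
open Filter Set TopologicalSpace

-- every `Summit.FinalStateConjecture.FinalStateConjecture.…` name repeats the summit = sub-problem
-- segment (D-0017 layout, CONVENTIONS §2); the duplicate is deliberate.
set_option linter.dupNamespace false

namespace Summit.FinalStateConjecture.FinalStateConjecture.Cruxes.KillingSpinorEndgame.Birth

open Summit.FinalStateConjecture.FinalStateConjecture.Theses.KerrnessPropagates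

noncomputable section

/-! ### §0 Waypoints — the crux's recurrence clause read back, and the one new typed object -/

section Waypoints

variable {X : Type} [TopologicalSpace X] [ChartedSpace E3 X] [IsManifold (𝓡 3) ∞ X]
  [ConnectedSpace X] {D : InitialDataSet (𝓡 3) X}

/-- **Recurrence to the configuration `(N; M, a, r₀; mo)` at regularity `k`** — verbatim the body of
clause (i) of the crux `KillingSpinorEndgame` after its configuration existential: for every
`ε > 0` and beyond every lab time `τ₁` there is ONE smooth open embedding `Φ` of a neighbourhood
`U` of the punctured hyperplane `{x⁰ = τ, ∀ j, r₀ⱼ < rⱼ}` with achronal slab image in `J⁺(ιX)`,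
`ε`-close in `Cᵏ` (sup) to boosted Kerr–Schild Kerrᵢ on the near discs `{r₀ᵢ < rᵢ ≤ Rᵢ}`,
`r₀ᵢ + 1 ≤ Rᵢ`, `ε`-flat on the far zone `{∀ j, rⱼ ≥ Rⱼ − 1}`, with `Φ_*∂₀` future-directed causal on
the far zone. [cite: DafermosLuk2017, Conjecture 1] -/
def Recurs (𝒟 : VacuumCauchyDevelopment D) (k N : ℕ) (M a r₀ : Fin N → ℝ)
    (mo : Fin N → ↥lorentzGroup × E4) : Prop :=
  ∀ ε : ℝ, 0 < ε → ∀ τ₁ : ℝ, ∃ τ : ℝ, τ₁ ≤ τ ∧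
    ∃ (R : Fin N → ℝ) (U : Opens E4) (Φ : U → 𝒟.carrier), (∀ i, r₀ i + 1 ≤ R i) ∧
      ContMDiff 𝓘(ℝ, E4) (𝓡 4) ∞ Φ ∧ Topology.IsOpenEmbedding Φ ∧
      {x : E4 | x 0 = τ ∧ ∀ j, r₀ j < Kerr.radius (a j) (poincareInv (mo j).1 (mo j).2 x)} ⊆
        (U : Set E4) ∧
      range Φ ⊆ 𝒟.metric.causalFuture 𝒟.timeOrientation (range 𝒟.embed) ∧
      𝒟.metric.IsAchronal 𝒟.timeOrientation (Φ '' {x : ↥U | (x : E4) 0 = τ}) ∧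
      (∀ i, supCkENorm {x : E4 | x 0 = τ ∧
          (∀ j, r₀ j < Kerr.radius (a j) (poincareInv (mo j).1 (mo j).2 x)) ∧
          Kerr.radius (a i) (poincareInv (mo i).1 (mo i).2 x) ≤ R i} k
        (𝒟.toSpacetime.deviationExtend ⟨U, boostedKerrBilin (mo i).1 (mo i).2 (M i) (a i),
          fun x ↦ x 0, fun x ↦ Kerr.radius (a i) (poincareInv (mo i).1 (mo i).2 x)⟩ Φ) ≤
        ENNReal.ofReal ε) ∧
      supCkENorm {x : E4 | x 0 = τ ∧
          (∀ j, r₀ j < Kerr.radius (a j) (poincareInv (mo j).1 (mo j).2 x)) ∧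
          ∀ j, R j - 1 ≤ Kerr.radius (a j) (poincareInv (mo j).1 (mo j).2 x)} k
        (𝒟.toSpacetime.deviationExtend (Minkowski.backgroundOn U) Φ) ≤ ENNReal.ofReal ε ∧
      (∀ x : ↥U, x.1 0 = τ →
        (∀ j, R j - 1 ≤ Kerr.radius (a j) (poincareInv (mo j).1 (mo j).2 x.1)) →
        𝒟.timeOrientation.IsFutureDirected (mfderiv 𝓘(ℝ, E4) (𝓡 4) Φ x (E4.basisVector 0)))

/-- **Global gauge along the accuracy profile `δ`** to the configuration `(N; M, a, r₀; mo)` at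
regularity `k` (the one new typed object of the line): ONE smooth open embedding `Φ` of a
neighbourhood `U` of the punctured late half-space `{x⁰ > τ₀, ∀ j, r₀ⱼ < rⱼ}` into `J⁺(ιX)` and
growing near-zone radii `Rᵢ(τ) → ∞` with `r₀ᵢ + 1 ≤ Rᵢ(τ)`, such that for EVERY lab time `τ > τ₀`
the leaf `Φ({x⁰ = τ})` is achronal, `Φ^* g` is `δ(τ)`-close in `Cᵏ` (sup) to boosted Kerr–Schild
Kerrᵢ on the near disc `{x⁰ = τ, r₀ᵢ < rᵢ ≤ Rᵢ(τ)}` of every hole and `δ(τ)`-close to `η` on the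
ADJACENT far zone `{x⁰ = τ, ∀ j, rⱼ ≥ Rⱼ(τ) − 1}`, and `Φ_*∂₀` is future-directed causal on that far
zone. The leafwise clauses are token-identical with the crux's recurrence slab clauses (with
`Rᵢ ↦ Rᵢ(τ)`, `ε ↦ δ(τ)`). Lab-time, horizon-penetrating, `N`-hole analogue of the prelude's
`Spacetime.RemainsCloseTo`/`ConvergesTo` (Dafermos–Holzegel–Rodnianski–Taylor arXiv:2104.08222,
§1: closeness / convergence in one global gauge; Klainerman–Szeftel 2023, Thm. 1.1).
[cite: arXiv210408222, §1] -/
def GaugeAlong (𝒟 : VacuumCauchyDevelopment D) (k N : ℕ) (M a r₀ : Fin N → ℝ)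
    (mo : Fin N → ↥lorentzGroup × E4) (δ : ℝ → ℝ) : Prop :=
  ∃ (U : Opens E4) (Φ : U → 𝒟.carrier) (τ₀ : ℝ) (R : Fin N → ℝ → ℝ),
    ContMDiff 𝓘(ℝ, E4) (𝓡 4) ∞ Φ ∧ Topology.IsOpenEmbedding Φ ∧
    {x : E4 | τ₀ < x 0 ∧ ∀ j, r₀ j < Kerr.radius (a j) (poincareInv (mo j).1 (mo j).2 x)} ⊆
      (U : Set E4) ∧
    range Φ ⊆ 𝒟.metric.causalFuture 𝒟.timeOrientation (range 𝒟.embed) ∧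
    (∀ i, Tendsto (R i) atTop atTop) ∧ (∀ i τ, r₀ i + 1 ≤ R i τ) ∧
    ∀ τ : ℝ, τ₀ < τ →
      𝒟.metric.IsAchronal 𝒟.timeOrientation (Φ '' {x : ↥U | (x : E4) 0 = τ}) ∧
      (∀ i, supCkENorm {x : E4 | x 0 = τ ∧
          (∀ j, r₀ j < Kerr.radius (a j) (poincareInv (mo j).1 (mo j).2 x)) ∧
          Kerr.radius (a i) (poincareInv (mo i).1 (mo i).2 x) ≤ R i τ} k
        (𝒟.toSpacetime.deviationExtend ⟨U, boostedKerrBilin (mo i).1 (mo i).2 (M i) (a i),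
          fun x ↦ x 0, fun x ↦ Kerr.radius (a i) (poincareInv (mo i).1 (mo i).2 x)⟩ Φ) ≤
        ENNReal.ofReal (δ τ)) ∧
      supCkENorm {x : E4 | x 0 = τ ∧
          (∀ j, r₀ j < Kerr.radius (a j) (poincareInv (mo j).1 (mo j).2 x)) ∧
          ∀ j, R j τ - 1 ≤ Kerr.radius (a j) (poincareInv (mo j).1 (mo j).2 x)} k
        (𝒟.toSpacetime.deviationExtend (Minkowski.backgroundOn U) Φ) ≤ ENNReal.ofReal (δ τ) ∧
      (∀ x : ↥U, x.1 0 = τ →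
        (∀ j, R j τ - 1 ≤ Kerr.radius (a j) (poincareInv (mo j).1 (mo j).2 x.1)) →
        𝒟.timeOrientation.IsFutureDirected (mfderiv 𝓘(ℝ, E4) (𝓡 4) Φ x (E4.basisVector 0)))

/-- **Convergent global gauge** to `(N; M, a, r₀; mo)` at regularity `k`: a global gauge along SOME
accuracy profile `δ` with `δ(τ) → 0` as `τ → ∞` (DHRT arXiv:2104.08222, §1; Klainerman–Szeftel
2023, Thm. 1.1: "converges in the global gauge"). [cite: arXiv210408222, §1] -/
def GlobalGauge (𝒟 : VacuumCauchyDevelopment D) (k N : ℕ) (M a r₀ : Fin N → ℝ)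
    (mo : Fin N → ↥lorentzGroup × E4) : Prop :=
  ∃ δ : ℝ → ℝ, Tendsto δ atTop (𝓝 0) ∧ GaugeAlong 𝒟 k N M a r₀ mo δ

/-- **Honest exterior decomposition** of the development `𝒟`: the conclusion of the re-typed
Statement minus its `RaysStayInClosure` conjunct — an `N`-hole `C²` `FinalStateDecomposition` `d`
with sub-extremal holes of the self-determined exterior `O = J⁺(ιX) ∩ I⁻(d.charted)`, with
exhaustive charts (honest growing radii) and future-oriented chart times.
[cite: DafermosLuk2017, Conjecture 1 (b)–(c)] -/
def HonestExterior (𝒟 : VacuumCauchyDevelopment D) : Prop :=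
  ∃ (O : Set 𝒟.carrier) (d : FinalStateDecomposition 𝒟.toSpacetime O 2),
    (∀ i, Kerr.IsSubextremal (d.mass i) (d.spin i)) ∧
    O = Summit.FinalStateConjecture.exteriorOf 𝒟.toCauchyDevelopment d.charted ∧
    Summit.FinalStateConjecture.HasExhaustiveCharts d ∧
    Summit.FinalStateConjecture.IsFutureOriented d

end Waypoints

/-! ### §1 The stub SIGNATURES (`Sig.stub_<name> : Prop`; the skeleton audit reads the hypotheses of
`KillingSpinorEndgame_of` BY NAME, heads = stub names) -/

/-- **Signature of stub 1 — DYNAMICS: a recurrent development is eventually captured at every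
accuracy.** There is a regularity `k` such that for every admissible datum, every MGHD with complete
`𝓘⁺` and every sub-extremal configuration `p = (N; Mᵢ, aᵢ, r₀ᵢ ∈ (r₋, r₊); Λᵢ, cᵢ)`: if the
development recurs to `p` at regularity `k` (`Recurs`, the crux's clause (i) verbatim), then there
are depths `r₀'ᵢ ∈ (r₋, r₊)` such that for EVERY `η > 0` it carries a global `C²` gauge along the
constant profile `η` to the SAME charges and motions (`GaugeAlong … (fun _ ↦ η)`): from some lab
time on, in ONE chart, every leaf is an `η`-good slab. Liminf-to-lim at each accuracy: orbital
(uniform) control of sub-extremal multi-Kerr in a lab-time horizon-penetrating gauge plus the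
monotone budgets (area theorem, Bondi mass loss) that forbid infinitely many `O(1)` kicks; no decay
rate. Why it might fail: contains uniform-in-time (orbital) nonlinear stability of sub-extremal
Kerr for all `|a| < M` in a horizon-penetrating lab gauge (open beyond `|a| ≪ M`) and an `N ≥ 2`
weak-interaction statement; with only an unweighted far-zone norm, infinitely many ever fainter but
ever wider incoming shells must be shown incompatible with recurrence of the masses (area
monotonicity) — if angular momentum can random-walk at square-summable energy cost, capture of the
spins `aᵢ` fails. [cite: DafermosRodnianski2008, Conj. 5.1] [cite: KlainermanSzeftel2023, Thm. 1.1]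
[cite: arXiv:0712.3373] [cite: AnderssonBlue2015] [cite: arXiv210408222, §1] -/
def Sig.stub_eventualCapture : Prop :=
  ∃ k : ℕ,
  ∀ (X : Type) [TopologicalSpace X] [ChartedSpace E3 X] [IsManifold (𝓡 3) ∞ X]
    [T2Space X] [SecondCountableTopology X] [ConnectedSpace X] (D : InitialDataSet (𝓡 3) X),
    D ∈ admissibleVacuumData X → ∀ 𝒟 : VacuumCauchyDevelopment D, 𝒟.IsMaximal →
    Summit.FinalStateConjecture.HasCompleteNullInfinity 𝒟.toCauchyDevelopment →
    ∀ (N : ℕ) (M a r₀ : Fin N → ℝ) (mo : Fin N → ↥lorentzGroup × E4),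
    (∀ i, Kerr.IsSubextremal (M i) (a i) ∧
      r₀ i ∈ Ioo (Kerr.rMinus (M i) (a i)) (Kerr.rPlus (M i) (a i))) →
    Recurs 𝒟 k N M a r₀ mo →
    ∃ r₀' : Fin N → ℝ, (∀ i, r₀' i ∈ Ioo (Kerr.rMinus (M i) (a i)) (Kerr.rPlus (M i) (a i))) ∧
      ∀ η : ℝ, 0 < η → GaugeAlong 𝒟 2 N M a r₀' mo (fun _ ↦ η)

/-- **Signature of stub 2 — CONSOLIDATION: gauges at every accuracy merge into one convergent
gauge.** For every admissible datum, every MGHD with complete `𝓘⁺` and every sub-extremal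
configuration with depths in `(r₋, r₊)`: global `C²` gauges along every constant profile `η > 0`
(possibly a different chart for each `η`) ⇒ ONE global `C²` gauge with accuracy `δ(τ) → 0`
(`GlobalGauge`). Mechanism: on a common late region two `η`-gauges differ, up to `O(η)` in `C²`, by
ONE exact symmetry of the references (a Poincaré map preserving every boosted Kerr–Schild Kerrᵢ:
time translation along `Λᵢ e₀`, axial rotation; for `N = 0` any Poincaré map) because near discs
and far zone are adjacent and the chart is a single diffeomorphism; realign by that exact symmetry
(free), interpolate geodesically across a long lab-time window (error `O(η)` + `O(1/window)`),
iterate along `ηₙ = 1/n`, diagonalise the radii. Why it might fail: the relative gauge map is only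
`O(η)`-close to a symmetry on the CERTIFIED part of each leaf; if the two charts' near-disc radii
`Rᵢ(τ)`, `Rᵢ'(τ)` are wildly different the overlap where both are certified may be too thin to pin
one common symmetry with uniform error on unbounded leaves. [cite: arXiv210408222, §1]
[cite: ONeill1983, Ch. 9] -/
def Sig.stub_gaugeConsolidation : Prop :=
  ∀ (X : Type) [TopologicalSpace X] [ChartedSpace E3 X] [IsManifold (𝓡 3) ∞ X]
    [T2Space X] [SecondCountableTopology X] [ConnectedSpace X] (D : InitialDataSet (𝓡 3) X),
    D ∈ admissibleVacuumData X → ∀ 𝒟 : VacuumCauchyDevelopment D, 𝒟.IsMaximal →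
    Summit.FinalStateConjecture.HasCompleteNullInfinity 𝒟.toCauchyDevelopment →
    ∀ (N : ℕ) (M a r₀ : Fin N → ℝ) (mo : Fin N → ↥lorentzGroup × E4),
    (∀ i, Kerr.IsSubextremal (M i) (a i) ∧
      r₀ i ∈ Ioo (Kerr.rMinus (M i) (a i)) (Kerr.rPlus (M i) (a i))) →
    (∀ η : ℝ, 0 < η → GaugeAlong 𝒟 2 N M a r₀ mo (fun _ ↦ η)) → GlobalGauge 𝒟 2 N M a r₀ mo

/-- **Signature of stub 3 — PACKAGING: a convergent global gauge packages into an honest exterior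
decomposition.** For every admissible datum, every MGHD with complete `𝓘⁺` and every sub-extremal
configuration with horizon-penetrating depths `r₀ᵢ ∈ (r₋, r₊)`: a convergent global `C²` gauge
(`GlobalGauge … 2`) yields an honest exterior decomposition (`HonestExterior`: sub-extremal holes,
`O = exteriorOf`, `HasExhaustiveCharts`, `IsFutureOriented`). Content: per-hole charts on the
boosted Kerr exteriors by a decaying radial renormalisation (event horizon inside the chart image)
and compression of the uncontrolled far part of each boosted exterior into the lab-late region;
flat chart on the late half-space minus sublinear tubes `ρᵢ ≤ Rᵢ − 1` (no annulus); growing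
certified radii by diagonalisation; exhaustion clause (ii) from the causal structure of
near-Kerr/near-flat leaves (lab time is a time function on late leaves; the cylinders `{rᵢ = r₀ᵢ}`,
`r₋ < r₀ᵢ < r₊`, are spacelike with future pointing inward); orientation of the hole charts from the
far-zone sign by continuity. Why it might fail: the Statement's certified slabs are BOOSTED-time
slabs `{t*ᵢ = τ₁}` while the gauge's leaves are lab-time slabs, so points of a near tube between the
two must be chased into `J⁻` of the certified slab along the hole's own time direction — this
needs the certified radii to dominate the excision radii uniformly along each tube, which the
packaging must arrange; and locating the event horizon within `o(1)` of `{rᵢ = r₊}` uses complete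
`𝓘⁺` only through the sojourn form. [cite: DafermosLuk2017, Conjecture 1 (b)–(c)]
[cite: arXiv210408222, §1] [cite: ONeill1983, Ch. 14] -/
def Sig.stub_exteriorPackaging : Prop :=
  ∀ (X : Type) [TopologicalSpace X] [ChartedSpace E3 X] [IsManifold (𝓡 3) ∞ X]
    [T2Space X] [SecondCountableTopology X] [ConnectedSpace X] (D : InitialDataSet (𝓡 3) X),
    D ∈ admissibleVacuumData X → ∀ 𝒟 : VacuumCauchyDevelopment D, 𝒟.IsMaximal →
    Summit.FinalStateConjecture.HasCompleteNullInfinity 𝒟.toCauchyDevelopment →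
    ∀ (N : ℕ) (M a r₀ : Fin N → ℝ) (mo : Fin N → ↥lorentzGroup × E4),
    (∀ i, Kerr.IsSubextremal (M i) (a i) ∧
      r₀ i ∈ Ioo (Kerr.rMinus (M i) (a i)) (Kerr.rPlus (M i) (a i))) →
    GlobalGauge 𝒟 2 N M a r₀ mo → HonestExterior 𝒟

/-! ### §2 The registered stubs (the ONLY `sorry`s of this file) -/

/-- Registered stub 1 (DYNAMICS, open-problem size; the crux's rank-2 difficulty lives here): a
recurrent development is eventually captured at every accuracy. See `Sig.stub_eventualCapture`. -/
theorem stub_eventualCapture : Sig.stub_eventualCapture := by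
  sorry

/-- Registered stub 2 (CONSOLIDATION, L): gauges at every accuracy merge into one convergent gauge.
See `Sig.stub_gaugeConsolidation`. -/
theorem stub_gaugeConsolidation : Sig.stub_gaugeConsolidation := by
  sorry

/-- Registered stub 3 (PACKAGING, L): a convergent global gauge packages into an honest exterior
decomposition. See `Sig.stub_exteriorPackaging`. -/
theorem stub_exteriorPackaging : Sig.stub_exteriorPackaging := by
  sorry

/-! ### §3 Composition: the three stubs imply the crux, BY NAME (real proof, no `sorry`) -/

/-- **The line closes the crux.** DYNAMICS (`stub_eventualCapture`), CONSOLIDATION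
(`stub_gaugeConsolidation`) and PACKAGING (`stub_exteriorPackaging`) imply
`KerrnessPropagates.KillingSpinorEndgame` BY NAME: take the dynamics stub's `k`; a development
recurring to a sub-extremal `p` is eventually captured at every accuracy (with red-shift depths
`r₀'`), the captures consolidate into one convergent global gauge, which packages into an honest
`(O, d)`; the crux's interior-lemma hypothesis (ii) applied to `(O, d)` gives `RaysStayInClosure O`.
Pure logic over the three stub statements; every hand-over is definitional (`Recurs` is
token-identical with the crux's clause (i)). -/
theorem KillingSpinorEndgame_of :
    Sig.stub_eventualCapture → Sig.stub_gaugeConsolidation → Sig.stub_exteriorPackaging →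
      KillingSpinorEndgame := by
  intro hcap hcons hpack
  unfold Sig.stub_eventualCapture at hcap
  unfold Sig.stub_gaugeConsolidation at hcons
  unfold Sig.stub_exteriorPackaging at hpack
  obtain ⟨k, hk⟩ := hcap
  refine ⟨k, ?_⟩
  intro X _ _ _ _ _ _ D hD 𝒟 hmax hscri hrec hint
  obtain ⟨N, M, a, r₀, mo, hsub, hrec⟩ := hrec
  obtain ⟨r₀', hr₀', hcapη⟩ := hk X D hD 𝒟 hmax hscri N M a r₀ mo hsub hrec
  have hsub' : ∀ i, Kerr.IsSubextremal (M i) (a i) ∧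
      r₀' i ∈ Ioo (Kerr.rMinus (M i) (a i)) (Kerr.rPlus (M i) (a i)) :=
    fun i ↦ ⟨(hsub i).1, hr₀' i⟩
  have hgg : GlobalGauge 𝒟 2 N M a r₀' mo := hcons X D hD 𝒟 hmax hscri N M a r₀' mo hsub' hcapη
  obtain ⟨O, d, hdsub, hO, hexh, hfo⟩ := hpack X D hD 𝒟 hmax hscri N M a r₀' mo hsub' hgg
  exact ⟨O, d, hdsub, hO, hint O d hdsub hO hexh hfo, hexh, hfo⟩

/-- Sanity: the composition applies to the three registered stubs as stated — the crux BY NAME,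
closed modulo exactly the three stubs (`KillingSpinorEndgame_of` itself is sorry-free). -/
example : KillingSpinorEndgame :=
  KillingSpinorEndgame_of stub_eventualCapture stub_gaugeConsolidation stub_exteriorPackaging

end

end Summit.FinalStateConjecture.FinalStateConjecture.Cruxes.KillingSpinorEndgame.Birth
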